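import Summits.FinalStateConjecture.FinalStateConjecture.Theorems.PhotonSphereChannelsCauchyWave
import Summits.FinalStateConjecture.FinalStateConjecture.Theorems.PhotonSphereChannelsFiniteSpeed
import Summits.FinalStateConjecture.FinalStateConjecture.Theorems.PhotonSphereChannelsExteriorEnergyRW

/-!
# Route PhotonSphereChannels — global `C²` solutions of `ψ_tt − ψ_xx + Vψ = 0` for ARBITRARY
# `C² × C¹` Cauchy data (no support restriction), uniqueness, and the Regge–Wheeler instance

Support file for the crux `WindowedShellChannels` (item stmt-FinalStateConjecture-14085, route
PhotonSphereChannels); registered stub **`stub_rwGlobalCauchy`** (`--supports`).  It removes the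
compact-support restriction of `CauchyWave.exists_solution` (prover seat 1, item 10045), which is
what the near/far splitting of data supported off the photon shell needs: the near and far pieces of
the data of a global solution are supported on HALF-LINES.

* `isSolution_lincomb` — linear combinations of global classical solutions are solutions.
* `curried_eq_zero_of_data` — domain of dependence in curried form: data vanishing on `[a, b]`
  force `φ(t, x) = 0` for `a + |t| ≤ x ≤ b − |t|` (`V ≥ 0` differentiable; port of
  `WaveEnergy.eq_zero_of_data_eq_zero` to the `iteratedDeriv`-of-slices form of the route decls).
* `solution_unique` — two global solutions with the same Cauchy data coincide.
* `exists_solution_global` — for `V ∈ C¹(ℝ)` bounded with `V ≥ 0`, `A ∈ C²`, `B ∈ C¹` (no support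
  hypothesis) there is a global `C²` solution with data `(A, B)`.  Proof: solve with the truncated
  data `(χ_n A, χ_n B)` (`χ_n` a smooth bump, `= 1` on `[−(n+1), n+1]`, `= 0` off `[−(n+2), n+2]`)
  by `CauchyWave.exists_solution`; two truncated solutions agree on `{|t| + |x| ≤ n + 1}` by the
  domain of dependence; glue `ψ(t, x) := ψ_{⌈|t|+|x|⌉}(t, x)`, which near every point is one
  truncated solution.
* `stub_rwGlobalCauchy` — the Regge–Wheeler instance along a tortoise radius function
  (`V_{s,ℓ} ∘ r` is `C¹`, bounded and positive for `s ≤ ℓ`).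

No definitions are introduced; standard material [folklore].
-/

noncomputable section

set_option linter.dupNamespace false

open Set Filter Topology Function Metric

namespace Summit.FinalStateConjecture.FinalStateConjecture.Theorems.CauchyWaveGlobal

open Literature.Geometry.Lorentzian Literature.Geometry.Lorentzian.ReggeWheeler
open Summit.FinalStateConjecture.FinalStateConjecture.Theorems

/-! ### Slices and linear combinations of `C²` functions of `(t, x)` -/

section LinComb

variable {V : ℝ → ℝ} {ψ₁ ψ₂ : ℝ → ℝ → ℝ}

/-- `t`-slices of a `C²` function of `(t, x)` are `C²`. -/
theorem contDiff_slice_fst (h : ContDiff ℝ 2 (uncurry ψ₁)) (x : ℝ) :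
    ContDiff ℝ 2 (fun τ => ψ₁ τ x) :=
  h.comp (contDiff_id.prodMk contDiff_const)

/-- `x`-slices of a `C²` function of `(t, x)` are `C²`. -/
theorem contDiff_slice_snd (h : ContDiff ℝ 2 (uncurry ψ₁)) (t : ℝ) :
    ContDiff ℝ 2 (ψ₁ t) :=
  h.comp (contDiff_const.prodMk contDiff_id)

/-- A linear combination of two `C²` functions of `(t, x)` is `C²`. -/
theorem contDiff_uncurry_lincomb (h₁ : ContDiff ℝ 2 (uncurry ψ₁))
    (h₂ : ContDiff ℝ 2 (uncurry ψ₂)) (a b : ℝ) :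
    ContDiff ℝ 2 (uncurry fun t x => a * ψ₁ t x + b * ψ₂ t x) :=
  (contDiff_const.mul h₁).add (contDiff_const.mul h₂)

/-- `∂_t` of a linear combination, slice form. -/
theorem deriv_lincomb_fst (h₁ : ContDiff ℝ 2 (uncurry ψ₁)) (h₂ : ContDiff ℝ 2 (uncurry ψ₂))
    (a b t x : ℝ) :
    deriv (fun τ => a * ψ₁ τ x + b * ψ₂ τ x) t
      = a * deriv (fun τ => ψ₁ τ x) t + b * deriv (fun τ => ψ₂ τ x) t := by
  have d₁ := (contDiff_slice_fst h₁ x).differentiable (by norm_num)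
  have d₂ := (contDiff_slice_fst h₂ x).differentiable (by norm_num)
  rw [deriv_fun_add ((d₁ t).const_mul a) ((d₂ t).const_mul b), deriv_const_mul_field,
    deriv_const_mul_field]

/-- `∂_x` of a linear combination, slice form. -/
theorem deriv_lincomb_snd (h₁ : ContDiff ℝ 2 (uncurry ψ₁)) (h₂ : ContDiff ℝ 2 (uncurry ψ₂))
    (a b t x : ℝ) :
    deriv (fun y => a * ψ₁ t y + b * ψ₂ t y) x = a * deriv (ψ₁ t) x + b * deriv (ψ₂ t) x := by
  have d₁ := (contDiff_slice_snd h₁ t).differentiable (by norm_num)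
  have d₂ := (contDiff_slice_snd h₂ t).differentiable (by norm_num)
  rw [deriv_fun_add ((d₁ x).const_mul a) ((d₂ x).const_mul b), deriv_const_mul_field,
    deriv_const_mul_field]

/-- `∂_t²` of a linear combination, slice form. -/
theorem iteratedDeriv_lincomb_fst (h₁ : ContDiff ℝ 2 (uncurry ψ₁))
    (h₂ : ContDiff ℝ 2 (uncurry ψ₂)) (a b t x : ℝ) :
    iteratedDeriv 2 (fun τ => a * ψ₁ τ x + b * ψ₂ τ x) t
      = a * iteratedDeriv 2 (fun τ => ψ₁ τ x) t + b * iteratedDeriv 2 (fun τ => ψ₂ τ x) t := by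
  have c₁ : ContDiffAt ℝ 2 (fun τ => a * ψ₁ τ x) t :=
    (contDiff_const.mul (contDiff_slice_fst h₁ x)).contDiffAt
  have c₂ : ContDiffAt ℝ 2 (fun τ => b * ψ₂ τ x) t :=
    (contDiff_const.mul (contDiff_slice_fst h₂ x)).contDiffAt
  rw [iteratedDeriv_fun_add c₁ c₂, iteratedDeriv_const_mul_field, iteratedDeriv_const_mul_field]

/-- `∂_x²` of a linear combination, slice form. -/
theorem iteratedDeriv_lincomb_snd (h₁ : ContDiff ℝ 2 (uncurry ψ₁))
    (h₂ : ContDiff ℝ 2 (uncurry ψ₂)) (a b t x : ℝ) :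
    iteratedDeriv 2 (fun y => a * ψ₁ t y + b * ψ₂ t y) x
      = a * iteratedDeriv 2 (ψ₁ t) x + b * iteratedDeriv 2 (ψ₂ t) x := by
  have c₁ : ContDiffAt ℝ 2 (fun y => a * ψ₁ t y) x :=
    (contDiff_const.mul (contDiff_slice_snd h₁ t)).contDiffAt
  have c₂ : ContDiffAt ℝ 2 (fun y => b * ψ₂ t y) x :=
    (contDiff_const.mul (contDiff_slice_snd h₂ t)).contDiffAt
  rw [iteratedDeriv_fun_add c₁ c₂, iteratedDeriv_const_mul_field, iteratedDeriv_const_mul_field]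

/-- **Linearity.** A linear combination of two global classical solutions of
`φ_tt − φ_xx + Vφ = 0` is a global classical solution. [folklore] -/
theorem isSolution_lincomb (h₁ : IsSolution V ψ₁) (h₂ : IsSolution V ψ₂) (a b : ℝ) :
    IsSolution V (fun t x => a * ψ₁ t x + b * ψ₂ t x) := by
  refine ⟨contDiff_uncurry_lincomb h₁.1 h₂.1 a b, fun z => ?_⟩
  obtain ⟨t, x⟩ := z
  have e₁ := h₁.2 (t, x)
  have e₂ := h₂.2 (t, x)
  unfold IsSolutionAt at e₁ e₂ ⊢
  simp only at e₁ e₂ ⊢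
  rw [iteratedDeriv_lincomb_fst h₁.1 h₂.1, iteratedDeriv_lincomb_snd h₁.1 h₂.1]
  linear_combination a * e₁ + b * e₂

end LinComb

/-! ### Domain of dependence and uniqueness, curried form -/

section Uniqueness

variable {V : ℝ → ℝ}

/-- **Domain of dependence, curried form.** For a global classical solution of
`φ_tt − φ_xx + Vφ = 0` (`V ≥ 0` differentiable) whose Cauchy data vanish on `[a, b]`,
`φ(t, x) = 0` whenever `a + |t| ≤ x ≤ b − |t|`. [folklore] -/
theorem curried_eq_zero_of_data (hV : Differentiable ℝ V) (hV0 : ∀ x, 0 ≤ V x)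
    {φ : ℝ → ℝ → ℝ} (hφ : IsSolution V φ) {a b : ℝ}
    (h0 : ∀ y ∈ Icc a b, φ 0 y = 0) (h1 : ∀ y ∈ Icc a b, deriv (fun τ => φ τ y) 0 = 0)
    {t x : ℝ} (hx1 : a + |t| ≤ x) (hx2 : x ≤ b - |t|) : φ t x = 0 := by
  have hC := hφ.1
  have hsol' : ∀ z : ℝ × ℝ, fderiv ℝ (fderiv ℝ (uncurry φ)) z (1, 0) (1, 0)
      - fderiv ℝ (fderiv ℝ (uncurry φ)) z (0, 1) (0, 1) + V z.2 * uncurry φ z = 0 := by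
    rintro ⟨τ, y⟩
    rw [← WaveEnergy.iteratedDeriv_two_slice_fst_eq hC, ← WaveEnergy.iteratedDeriv_two_slice_snd_eq hC]
    exact hφ.2 (τ, y)
  have hd0 : ∀ y ∈ Icc a b, uncurry φ (0, y) = 0 := fun y hy => h0 y hy
  have hd1 : ∀ y ∈ Icc a b, fderiv ℝ (uncurry φ) (0, y) (1, 0) = 0 := by
    intro y hy
    rw [← WaveEnergy.deriv_slice_fst_eq hC]
    exact h1 y hy
  have h := WaveEnergy.eq_zero_of_data_eq_zero hC hV hV0 hsol' (a := a) (b := b) (t₁ := 0) hd0 hd1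
    (t := t) (x := x) (by rw [sub_zero]; exact hx1) (by rw [sub_zero]; exact hx2)
  exact h

/-- **Uniqueness of the global Cauchy problem.** Two global classical solutions of
`φ_tt − φ_xx + Vφ = 0` (`V ≥ 0` differentiable) with the same Cauchy data at `t = 0` coincide.
[folklore] -/
theorem solution_unique (hV : Differentiable ℝ V) (hV0 : ∀ x, 0 ≤ V x)
    {ψ₁ ψ₂ : ℝ → ℝ → ℝ} (h₁ : IsSolution V ψ₁) (h₂ : IsSolution V ψ₂)
    (hd0 : ∀ x, ψ₁ 0 x = ψ₂ 0 x)
    (hd1 : ∀ x, deriv (fun τ => ψ₁ τ x) 0 = deriv (fun τ => ψ₂ τ x) 0) : ψ₁ = ψ₂ := by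
  funext t x
  have hsol := isSolution_lincomb h₁ h₂ 1 (-1)
  have h0 : ∀ y ∈ Icc (x - |t|) (x + |t|), (fun t x => 1 * ψ₁ t x + -1 * ψ₂ t x) 0 y = 0 := by
    intro y _
    simp only [hd0 y]
    ring
  have h1 : ∀ y ∈ Icc (x - |t|) (x + |t|),
      deriv (fun τ => (fun t x => 1 * ψ₁ t x + -1 * ψ₂ t x) τ y) 0 = 0 := by
    intro y _
    simp only
    rw [deriv_lincomb_fst h₁.1 h₂.1, hd1 y]
    ring
  have h := curried_eq_zero_of_data hV hV0 hsol h0 h1 (t := t) (x := x) (by linarith) (by linarith)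
  linarith

end Uniqueness

/-! ### Global existence for arbitrary `C² × C¹` data -/

section Existence

/-- **Global classical solutions for arbitrary data.** For `V ∈ C¹(ℝ)` bounded with `V ≥ 0`,
`A ∈ C²(ℝ)` and `B ∈ C¹(ℝ)` there is `ψ ∈ C²(ℝ²)` with `ψ_tt − ψ_xx + Vψ = 0` everywhere
(`iteratedDeriv`-of-slices form), `ψ(0, ·) = A` and `ψ_t(0, ·) = B`. [folklore] -/
theorem exists_solution_global {V A B : ℝ → ℝ} {CV : ℝ} (hV : ContDiff ℝ 1 V)
    (hVb : ∀ x, |V x| ≤ CV) (hV0 : ∀ x, 0 ≤ V x) (hA : ContDiff ℝ 2 A) (hB : ContDiff ℝ 1 B) :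
    ∃ ψ : ℝ → ℝ → ℝ, ContDiff ℝ 2 (uncurry ψ) ∧
      (∀ t x, iteratedDeriv 2 (fun τ => ψ τ x) t - iteratedDeriv 2 (ψ t) x + V x * ψ t x = 0) ∧
      (∀ x, ψ 0 x = A x) ∧ (∀ x, deriv (fun τ => ψ τ x) 0 = B x) := by
  -- smooth cutoffs `χ_n = 1` on `[−(n+1), n+1]`, `= 0` off `[−(n+2), n+2]`
  have hχ : ∀ n : ℕ, ∃ χ : ℝ → ℝ, ContDiff ℝ 2 χ ∧ (∀ x : ℝ, |x| ≤ (n : ℝ) + 1 → χ x = 1) ∧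
      (∀ x : ℝ, x ∉ Icc (-((n : ℝ) + 2)) ((n : ℝ) + 2) → χ x = 0) := by
    intro n
    let f : ContDiffBump (0 : ℝ) := ⟨(n : ℝ) + 1, (n : ℝ) + 2, by positivity, by linarith⟩
    refine ⟨f, f.contDiff, fun x hx => f.one_of_mem_closedBall ?_, fun x hx => f.zero_of_le_dist ?_⟩
    · rw [mem_closedBall, dist_zero_right, Real.norm_eq_abs]
      exact hx
    · rw [Real.dist_eq, sub_zero]
      simp only [mem_Icc, not_and_or, not_le] at hx
      show (n : ℝ) + 2 ≤ |x|
      rcases hx with hx | hx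
      · linarith [neg_abs_le x]
      · linarith [le_abs_self x]
  choose χ hχC hχ1 hχ0 using hχ
  -- truncated solutions
  have hsol : ∀ n : ℕ, ∃ ψ : ℝ → ℝ → ℝ, ContDiff ℝ 2 (uncurry ψ) ∧
      (∀ t x, iteratedDeriv 2 (fun τ => ψ τ x) t - iteratedDeriv 2 (ψ t) x + V x * ψ t x = 0) ∧
      (∀ x, ψ 0 x = χ n x * A x) ∧ (∀ x, deriv (fun τ => ψ τ x) 0 = χ n x * B x) := by
    intro n
    obtain ⟨ψ, h1, h2, h3, h4, -⟩ := CauchyWave.exists_solution (α := -((n : ℝ) + 2))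
      (β := (n : ℝ) + 2) hV hVb ((hχC n).mul hA) (fun x hx => by rw [hχ0 n x hx, zero_mul])
      (((hχC n).of_le (by norm_num)).mul hB) (fun x hx => by rw [hχ0 n x hx, zero_mul])
    exact ⟨ψ, h1, h2, h3, h4⟩
  choose ψn hC hS hD0 hD1 using hsol
  have hV' : Differentiable ℝ V := hV.differentiable (by norm_num)
  have hIs : ∀ n, IsSolution V (ψn n) := fun n => ⟨hC n, fun z => hS n z.1 z.2⟩
  -- two truncated solutions agree on `{|t| + |x| ≤ n + 1}`
  have hagree : ∀ n m : ℕ, n ≤ m → ∀ t x : ℝ, |t| + |x| ≤ (n : ℝ) + 1 → ψn m t x = ψn n t x := by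
    intro n m hnm t x htx
    have hnm' : (n : ℝ) ≤ m := by exact_mod_cast hnm
    have hsol := isSolution_lincomb (hIs m) (hIs n) 1 (-1)
    have h0 : ∀ y ∈ Icc (-((n : ℝ) + 1)) ((n : ℝ) + 1),
        (fun t x => 1 * ψn m t x + -1 * ψn n t x) 0 y = 0 := by
      intro y hy
      have hy' : |y| ≤ (n : ℝ) + 1 := abs_le.mpr ⟨by linarith [hy.1], hy.2⟩
      simp only
      rw [hD0 m, hD0 n, hχ1 m y (by linarith), hχ1 n y hy']
      ring
    have h1 : ∀ y ∈ Icc (-((n : ℝ) + 1)) ((n : ℝ) + 1),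
        deriv (fun τ => (fun t x => 1 * ψn m t x + -1 * ψn n t x) τ y) 0 = 0 := by
      intro y hy
      have hy' : |y| ≤ (n : ℝ) + 1 := abs_le.mpr ⟨by linarith [hy.1], hy.2⟩
      rw [deriv_lincomb_fst (hC m) (hC n), hD1 m, hD1 n, hχ1 m y (by linarith), hχ1 n y hy']
      ring
    have h := curried_eq_zero_of_data hV' hV0 hsol h0 h1 (t := t) (x := x)
      (by linarith [neg_abs_le x]) (by linarith [le_abs_self x])
    linarith
  -- local representation of the glued function by ONE truncated solution
  have hloc : ∀ t₀ x₀ : ℝ, ∀ᶠ z in 𝓝 (t₀, x₀),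
      uncurry (fun t x => ψn ⌈|t| + |x|⌉₊ t x) z = uncurry (ψn (⌈|t₀| + |x₀|⌉₊ + 1)) z := by
    intro t₀ x₀
    have hopen : IsOpen {z : ℝ × ℝ | |z.1| + |z.2| < |t₀| + |x₀| + 1} :=
      isOpen_lt (by fun_prop) continuous_const
    have hmem : (t₀, x₀) ∈ {z : ℝ × ℝ | |z.1| + |z.2| < |t₀| + |x₀| + 1} := by
      simp only [mem_setOf_eq]; linarith
    filter_upwards [hopen.mem_nhds hmem] with z hz
    have hz' : |z.1| + |z.2| < |t₀| + |x₀| + 1 := hz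
    show ψn ⌈|z.1| + |z.2|⌉₊ z.1 z.2 = ψn (⌈|t₀| + |x₀|⌉₊ + 1) z.1 z.2
    symm
    refine hagree _ _ ?_ z.1 z.2 ((Nat.le_ceil _).trans (le_add_of_nonneg_right zero_le_one))
    refine Nat.ceil_le.mpr ?_
    push_cast
    linarith [Nat.le_ceil (|t₀| + |x₀|)]
  refine ⟨fun t x => ψn ⌈|t| + |x|⌉₊ t x, ?_, ?_, ?_, ?_⟩
  · rw [contDiff_iff_contDiffAt]
    rintro ⟨t₀, x₀⟩
    exact (hC _).contDiffAt.congr_of_eventuallyEq (hloc t₀ x₀)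
  · intro t x
    beta_reduce
    have h2 := hloc t x
    have ht : (fun τ => ψn ⌈|τ| + |x|⌉₊ τ x) =ᶠ[𝓝 t] fun τ => ψn (⌈|t| + |x|⌉₊ + 1) τ x :=
      ((continuous_id.prodMk continuous_const).tendsto t).eventually h2
    have hx : (fun y => ψn ⌈|t| + |y|⌉₊ t y) =ᶠ[𝓝 x] fun y => ψn (⌈|t| + |x|⌉₊ + 1) t y :=
      ((continuous_const.prodMk continuous_id).tendsto x).eventually h2
    have hv : ψn ⌈|t| + |x|⌉₊ t x = ψn (⌈|t| + |x|⌉₊ + 1) t x := h2.self_of_nhds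
    rw [ht.iteratedDeriv_eq 2, hx.iteratedDeriv_eq 2, hv]
    exact hS _ t x
  · intro x
    show ψn ⌈|(0 : ℝ)| + |x|⌉₊ 0 x = A x
    have hle : |x| ≤ (⌈|(0 : ℝ)| + |x|⌉₊ : ℝ) + 1 := by
      have := Nat.le_ceil (|(0 : ℝ)| + |x|)
      rw [abs_zero, zero_add] at this ⊢
      linarith
    rw [hD0, hχ1 _ x hle, one_mul]
  · intro x
    have h2 := hloc 0 x
    have ht : (fun τ => ψn ⌈|τ| + |x|⌉₊ τ x) =ᶠ[𝓝 0] fun τ => ψn (⌈|(0 : ℝ)| + |x|⌉₊ + 1) τ x :=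
      ((continuous_id.prodMk continuous_const).tendsto 0).eventually h2
    have hle : |x| ≤ ((⌈|(0 : ℝ)| + |x|⌉₊ + 1 : ℕ) : ℝ) + 1 := by
      have := Nat.le_ceil (|(0 : ℝ)| + |x|)
      rw [abs_zero, zero_add] at this ⊢
      push_cast
      linarith
    show deriv (fun τ => ψn ⌈|τ| + |x|⌉₊ τ x) 0 = B x
    rw [ht.deriv_eq, hD1, hχ1 _ x hle, one_mul]

end Existence

/-! ### The Regge–Wheeler instance (registered stub `stub_rwGlobalCauchy`) -/

/-- **Registered stub `stub_rwGlobalCauchy`** (crux `WindowedShellChannels`,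
item stmt-FinalStateConjecture-14085): along a tortoise radius function, for `s ≤ ℓ` and ARBITRARY
data `A ∈ C²`, `B ∈ C¹` there is a global `C²` Regge–Wheeler solution with Cauchy data `(A, B)`
(and it is unique, `solution_unique`). -/
theorem stub_rwGlobalCauchy : ∀ (M : ℝ) (r : ℝ → ℝ) (xc : ℝ), IsTortoiseRadius M r xc → ∀ (s ℓ : ℕ), s ≤ ℓ → ∀ (A B : ℝ → ℝ), ContDiff ℝ 2 A → ContDiff ℝ 1 B → ∃ ψ : ℝ → ℝ → ℝ, IsRWSolution M s ℓ r ψ ∧ (∀ x, ψ 0 x = A x) ∧ ∀ x, deriv (fun τ => ψ τ x) 0 = B x := by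
  intro M r xc hr s ℓ hsℓ A B hA hB
  obtain ⟨ψ, h1, h2, h3, h4⟩ := exists_solution_global (CauchyWave.contDiff_one_linePotential hr s ℓ)
    (CauchyWave.abs_linePotential_le hr hsℓ) (fun x => (RW.linePotential_pos hr hsℓ x).le) hA hB
  exact ⟨ψ, ⟨h1, fun z => h2 z.1 z.2⟩, h3, h4⟩

end Summit.FinalStateConjecture.FinalStateConjecture.Theorems.CauchyWaveGlobal

end
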